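import Mathlib
import HarnessLib
import Literature.Analysis.FluidPDE.ClassicalSolution
import Literature.Analysis.FluidPDE.LerayHopf
import Literature.Analysis.FluidPDE.SuitableWeak
import Literature.Analysis.FluidPDE.TaoLocalisation
import Literature.Analysis.FluidPDE.TaoLocalisationHolds
import Summits.NavierStokesRegularity.NavierStokesRegularity.Theorems.QuarterJoltEdgeLawClass

/-!
# Route QuarterJolt — crux `NoTerminalJolt` (stmt-NavierStokesRegularity-26463): the EDGE LAW, III.
# The bootstrap on closed sub-slabs and the explicit edge law

Seat ns-qj-p1 g2 (`--supports 26463 --as helper`); third of four files.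

THE STATEMENT (`EdgeLaw.integral_norm_sub_sq_le`). Let `ν > 0`, `T > 0`, `(u, p)` a classical
solution of the unforced Navier–Stokes system on `[0, T) × ℝ³`, Leray–Hopf on `[0, T]` from its
rapidly decaying datum (the frame of the crux `NoTerminalJolt`). Suppose the SLICE LAW
`∫|curl u(τ)|² ≤ K/√(T−τ)` on `[0, T)` (`K ≥ 0`; the conclusion of the shelf crux
`EnstrophyQuarterLaw`) and the TYPE-I RATE `‖u(τ, x)‖ ≤ C/√(T−τ)` on `(T₁, T)` (`T₁ ≥ 0`; for a
quarter-law solution this is the landed item `RecordTimeTypeI`, used in file IV). Then for every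
`t ∈ (T₁, T)`:

  `∫ ‖u(t) − u(T)‖² ≤ (64 C² + ν) K √(T−t)`,  i.e.  `D(t) ≤ (64 C² + ν) K`.

PROOF (energy method; no `H²` estimate). Fix `T₁ < t < s < T` and the closed slab `[0, S]`,
`S = (s+T)/2`. By Tao 2013 Cor. 11.1 (tree theorem `tao2011_hasBoundedSobolevNormsOn_holds`) the
solution is in the Beale–Kato–Majda class on `[0, S]`, so the `L²` balance
`E(σ) = ∫_t^σ Φ` holds for `w = u − u(t)`, `E = ∫‖w‖²`, `Φ = 2∫⟪w, ∂ₜu⟫`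
(`IsSmoothSpaceTimeOn.l2_balance`). The slice inequality (`slice_le_of_classical`) with
`M = C/√(T−τ)`, `∫|Du(τ)|² ≤ K/√(T−τ)`, `∫|Du(t)|² ≤ K/√(T−t)` and the weight
`λ(τ) = (T−τ)^{-3/4}/(8(T−t)^{1/4})` gives, with `Y = max_{[t,s]} E` (attained, `E` continuous),
`Φ(τ) ≤ (ν/2)K/√(T−t) + (Y/(8(T−t)^{1/4}) + 8(T−t)^{1/4}C²K)(T−τ)^{-3/4}`, whence
`Y ≤ (ν/2)K√(T−t) + Y/2 + 32C²K√(T−t)`, `Y ≤ (64C² + ν)K√(T−t)`; finally `s ↑ T` by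
`integral_norm_sub_sq_terminal_le`. Also: `joltFunctional_le` (the same for `D(t)`),
`exists_integral_norm_sub_sq_le_of_isTypeIBlowup` (hypothesis `IsTypeIBlowup u T`, any `K`).

HONEST FRAMING: a conditional statement about a HYPOTHETICAL quarter-law blow-up (it calibrates the
crux; it does not move it). Nothing here proves `EnstrophyQuarterLaw` (stmt-1574), `NoTerminalJolt`
(stmt-26463) or Navier–Stokes regularity; all three stay OPEN. No summit statement is proved here.
[folklore]
-/

noncomputable section

-- the summit and its single sub-problem share the name (CONVENTIONS §1), as in every Theorems file
set_option linter.dupNamespace false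

namespace Summit.NavierStokesRegularity.NavierStokesRegularity.Theorems

open MeasureTheory Set Function Filter Topology InnerProductSpace
open scoped ENNReal NNReal ContDiff RealInnerProductSpace Laplacian
open Literature.Analysis.FluidPDE

namespace EdgeLaw

/-! ### The edge law on closed sub-slabs -/

/-- **The edge law before the terminal time.** Frame: `ν > 0`, `T > 0`, `(u, p)` classical on
`[0, T) × ℝ³`, Leray–Hopf on `[0, T]` from the rapidly decaying datum `u 0`; slice law
`∫|curl u(τ)|² ≤ K/√(T−τ)` on `[0, T)` (`K ≥ 0`) and the Type-I rate `‖u(τ, x)‖ ≤ C/√(T−τ)` on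
`(T₁, T)` (`T₁ ≥ 0`). Then for `T₁ < t < s < T`:
`∫‖u(s) − u(t)‖² ≤ (64 C² + ν) K √(T−t)`.
Proof: on the closed slab `[0, S]`, `S = (s+T)/2`, the solution is in Tao's class
(`tao2011_hasBoundedSobolevNormsOn_holds`); the `L²` balance of `w = u − u(t)`
(`IsSmoothSpaceTimeOn.l2_balance`) and the slice inequality `slice_le_of_classical` with the weight
`λ(τ) = (T−τ)^{-3/4}/(8(T−t)^{1/4})` give, for `Y = max_{[t,s]} ∫‖u − u(t)‖²`,
`Y ≤ (ν/2)K√(T−t) + Y/2 + 32C²K√(T−t)`. [folklore] -/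
theorem integral_norm_sub_sq_le_of_lt {ν T K C T₁ : ℝ} (hν : 0 < ν) (hK : 0 ≤ K)
    (hT₁ : 0 ≤ T₁) {u : ℝ → EuclideanSpace ℝ (Fin 3) → EuclideanSpace ℝ (Fin 3)}
    {p : ℝ → EuclideanSpace ℝ (Fin 3) → ℝ}
    (hsol : IsClassicalNSSolutionOn (Ico 0 T) ν 0 u p) (hLH : IsLerayHopfOn T ν 0 (u 0) u)
    (hdec : HasRapidSpatialDecay (u 0))
    (hslice : ∀ τ ∈ Ico 0 T, ∫⁻ x, ‖curl (u τ) x‖ₑ ^ 2 ≤ ENNReal.ofReal (K / Real.sqrt (T - τ)))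
    (hI : ∀ τ ∈ Ioo T₁ T, ∀ x, ‖u τ x‖ ≤ C / Real.sqrt (T - τ))
    {t s : ℝ} (ht : t ∈ Ioo T₁ T) (hs : s ∈ Ioo t T) :
    ∫ x, ‖u s x - u t x‖ ^ 2 ≤ (64 * C ^ 2 + ν) * K * Real.sqrt (T - t) := by
  -- the closed sub-slab `[0, S]`
  obtain ⟨S, hsS, hST⟩ : ∃ S, s < S ∧ S < T := ⟨(s + T) / 2, by linarith [hs.2], by linarith [hs.2]⟩
  have ht0 : 0 < t := lt_of_le_of_lt hT₁ ht.1
  have hS : 0 < S := by linarith [hs.1]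
  have hUI : UniqueDiffOn ℝ (Icc 0 S) := uniqueDiffOn_Icc hS
  have hsolS : IsClassicalNSSolutionOn (Icc 0 S) ν 0 u p :=
    hsol.mono (Icc_subset_Ico_right hST) hUI
  have hE' : ∃ C' : ℝ≥0, ∀ τ ∈ Icc 0 S, ∫⁻ x, ‖u τ x‖ₑ ^ 2 ≤ C' :=
    ⟨(2 * VectorCalculus.kineticEnergy (u 0)).toNNReal, fun τ hτ =>
      (hLH.lintegral_enorm_sq_le hν.le ⟨hτ.1, hτ.2.trans hST.le⟩).trans le_rfl⟩
  have hB : HasBoundedSobolevNormsOn (Icc 0 S) u :=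
    tao2011_hasBoundedSobolevNormsOn_holds hν hS hsolS hE' hdec
  have hu : ∀ τ ∈ Icc 0 S, ContDiff ℝ ∞ (u τ) := fun τ hτ => hsolS.contDiff_velocity hτ
  have htS : t ∈ Icc 0 S := ⟨ht0.le, (hs.1.trans hsS).le⟩
  have htT : t ∈ Ico 0 T := ⟨ht0.le, ht.2⟩
  -- Sobolev data of the slices
  obtain ⟨C₀, hC₀⟩ := hB 0
  obtain ⟨C₁, hC₁⟩ := hB 1
  have l2sl : ∀ τ ∈ Icc 0 S, ∫⁻ x, ‖u τ x‖ₑ ^ 2 < ⊤ := fun τ hτ => by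
    refine lt_of_le_of_lt (le_of_eq (lintegral_congr fun x => ?_))
      ((hC₀ τ hτ).trans_lt ENNReal.coe_lt_top)
    rw [← ofReal_norm, ← ofReal_norm, norm_iteratedFDeriv_zero]
  have l2Dsl : ∀ τ ∈ Icc 0 S, ∫⁻ x, ‖fderiv ℝ (u τ) x‖ₑ ^ 2 < ⊤ := fun τ hτ =>
    lintegral_enorm_sq_lt_top_of_norm_le (fun x => by
      rw [← norm_iteratedFDeriv_fderiv, norm_iteratedFDeriv_zero])
      ((hC₁ τ hτ).trans_lt ENNReal.coe_lt_top)
  -- the frozen slice `U = u t` and its enstrophy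
  have hUt : ContDiff ℝ 1 (u t) := (hu t htS).of_le (by norm_cast)
  have hGt := integral_frobeniusNormSq_le_of_curl ((hu t htS).of_le (by norm_cast))
    (hsol.divFree t htT) (l2sl t htS) (l2Dsl t htS) (by positivity : 0 ≤ K / Real.sqrt (T - t))
    (hslice t htT)
  -- the difference field `w = u − u(t)` on `[0, S]`
  obtain ⟨w, hwdef⟩ : ∃ w : ℝ → EuclideanSpace ℝ (Fin 3) → EuclideanSpace ℝ (Fin 3),
      w = fun τ x => u τ x - u t x := ⟨_, rfl⟩
  have hwtx : ∀ τ x, w τ x = u τ x - u t x := fun τ x => by rw [hwdef]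
  have hconst :
      IsSmoothSpaceTimeOn (Icc 0 S) (fun (_ : ℝ) (x : EuclideanSpace ℝ (Fin 3)) => u t x) := by
    have hc : ContDiff ℝ ∞ (uncurry fun (_ : ℝ) (x : EuclideanSpace ℝ (Fin 3)) => u t x) :=
      (hu t htS).comp contDiff_snd
    exact hc.contDiffOn
  have hwsm : IsSmoothSpaceTimeOn (Icc 0 S) w := by
    rw [hwdef]; exact hsolS.smooth_velocity.sub hconst
  have hWt : ∀ τ ∈ Icc 0 S, ∀ x, timeDerivWithin (Icc 0 S) w τ x = timeDerivWithin (Icc 0 S) u τ x := by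
    intro τ hτ x
    rw [hwdef, hsolS.smooth_velocity.timeDerivWithin_fun_sub hconst hUI hτ x]
    simp [timeDerivWithin_apply]
  -- `L²` bounds of `w` and `∂ₜw` on the slab
  have hzero : ∀ σ ∈ Icc 0 S, ∫⁻ x, ‖u σ x‖ₑ ^ 2 ≤ C₀ := fun σ hσ => by
    refine (le_of_eq (lintegral_congr fun x => ?_)).trans (hC₀ σ hσ)
    rw [← ofReal_norm, ← ofReal_norm, norm_iteratedFDeriv_zero]
  have hwL2 : ∀ τ ∈ Icc 0 S, ∫⁻ x, ‖w τ x‖ₑ ^ 2 ≤ (2 * C₀ + 2 * C₀ : ℝ≥0) := by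
    intro τ hτ
    have h := lintegral_enorm_sq_sub_le (g := u t)
      ((hsolS.contDiff_velocity hτ).continuous.aestronglyMeasurable) (μ := volume)
    calc ∫⁻ x, ‖w τ x‖ₑ ^ 2 = ∫⁻ x, ‖u τ x - u t x‖ₑ ^ 2 := lintegral_congr fun x => by rw [hwtx]
      _ ≤ 2 * (∫⁻ x, ‖u τ x‖ₑ ^ 2) + 2 * ∫⁻ x, ‖u t x‖ₑ ^ 2 := h
      _ ≤ 2 * (C₀ : ℝ≥0∞) + 2 * (C₀ : ℝ≥0∞) := by
          gcongr
          · exact hzero τ hτ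
          · exact hzero t htS
      _ = ((2 * C₀ + 2 * C₀ : ℝ≥0) : ℝ≥0∞) := by push_cast; rfl
  obtain ⟨Λ, hΛtop, hΛ⟩ := hsolS.exists_lintegral_enorm_timeDerivWithin_sq_le hν.le hS hB
  have hWL2 : ∀ τ ∈ Icc 0 S, ∫⁻ x, ‖timeDerivWithin (Icc 0 S) w τ x‖ₑ ^ 2 ≤ Λ.toNNReal := by
    intro τ hτ
    rw [ENNReal.coe_toNNReal hΛtop]
    refine (le_of_eq (lintegral_congr fun x => ?_)).trans (hΛ τ hτ)
    rw [hWt τ hτ x]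
  obtain ⟨hΦint, hEcont, hEb⟩ := hwsm.l2_balance hS hwL2 hWL2
  -- names for the energy and the flux
  obtain ⟨E, hEdef⟩ : ∃ E : ℝ → ℝ, E = fun τ => ∫ x, ‖w τ x‖ ^ 2 := ⟨_, rfl⟩
  have hEτ : ∀ τ, E τ = ∫ x, ‖w τ x‖ ^ 2 := fun τ => by rw [hEdef]
  obtain ⟨Φ, hΦdef⟩ : ∃ Φ : ℝ → ℝ,
      Φ = fun τ => ∫ x, 2 * ⟪w τ x, timeDerivWithin (Icc 0 S) w τ x⟫ := ⟨_, rfl⟩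
  have hΦτ : ∀ τ, Φ τ = ∫ x, 2 * ⟪w τ x, timeDerivWithin (Icc 0 S) w τ x⟫ := fun τ => by rw [hΦdef]
  rw [← hΦdef] at hΦint
  rw [← hEdef] at hEcont
  have hEb' : ∀ b ∈ Ioc 0 S, E b = E 0 + ∫ τ in (0 : ℝ)..b, Φ τ := by
    intro b hb
    rw [hEτ, hEτ, hΦdef]
    exact hEb b hb
  have hE0 : ∀ τ, 0 ≤ E τ := fun τ => by rw [hEτ]; exact integral_nonneg fun x => sq_nonneg _
  have hEt : E t = 0 := by rw [hEτ]; simp [hwtx]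
  -- `E σ = ∫_t^σ Φ` for `σ ∈ [t, s]`
  have hΦii : ∀ a b : ℝ, 0 ≤ a → b ≤ S → a ≤ b → IntervalIntegrable Φ volume a b :=
    fun a b ha hb hab =>
      (intervalIntegrable_iff_integrableOn_Ioo_of_le hab).2 (hΦint.mono_set (Ioo_subset_Ioo ha hb))
  have hEσ : ∀ σ ∈ Icc t s, E σ = ∫ τ in t..σ, Φ τ := by
    intro σ hσ
    have hσS : σ ∈ Ioc 0 S := ⟨ht0.trans_le hσ.1, (hσ.2.trans_lt hsS).le⟩
    have h1 := hEb' σ hσS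
    have h2 := hEb' t ⟨ht0, htS.2⟩
    have h3 := intervalIntegral.integral_interval_sub_left (hΦii 0 σ le_rfl hσS.2 hσS.1.le)
      (hΦii 0 t le_rfl htS.2 ht0.le)
    rw [hEt] at h2
    linarith
  -- the maximum `Y` of `E` on `[t, s]`
  obtain ⟨σm, hσm, hmax⟩ := isCompact_Icc.exists_isMaxOn (nonempty_Icc.2 hs.1.le)
    (hEcont.mono (Icc_subset_Icc ht0.le hsS.le))
  have hYge : ∀ τ ∈ Icc t s, E τ ≤ E σm := fun τ hτ => hmax hτ
  obtain ⟨Y, hYdef⟩ : ∃ Y : ℝ, Y = E σm := ⟨_, rfl⟩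
  have hY0 : 0 ≤ Y := by rw [hYdef]; exact hE0 σm
  -- the fourth root `q = (T - t)^{1/4}`
  have hTt : 0 < T - t := sub_pos.2 ht.2
  obtain ⟨q, hqdef⟩ : ∃ q : ℝ, q = Real.sqrt (Real.sqrt (T - t)) := ⟨_, rfl⟩
  have hq2 : q ^ 2 = Real.sqrt (T - t) := by rw [hqdef, Real.sq_sqrt (Real.sqrt_nonneg _)]
  have hq4 : (q ^ 2) ^ 2 = T - t := by rw [hq2, Real.sq_sqrt hTt.le]
  have hqpos : 0 < q := by rw [hqdef]; exact Real.sqrt_pos.2 (Real.sqrt_pos.2 hTt)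
  -- the frozen enstrophy `G ≤ K / √(T - t)`
  obtain ⟨G, hGdef⟩ : ∃ G : ℝ, G = ∫ x, frobeniusNormSq (fderiv ℝ (u t) x) := ⟨_, rfl⟩
  have hGle : G ≤ K / q ^ 2 := by rw [hGdef, hq2]; exact hGt.2
  -- the comparison function `a + b h`
  obtain ⟨a, hadef⟩ : ∃ a : ℝ, a = ν / 2 * (K / q ^ 2) := ⟨_, rfl⟩
  obtain ⟨b, hbdef⟩ : ∃ b : ℝ, b = Y / (8 * q) + 8 * q * C ^ 2 * K := ⟨_, rfl⟩
  have ha0 : 0 ≤ a := by rw [hadef]; positivity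
  have hb0 : 0 ≤ b := by rw [hbdef]; positivity
  -- the slice bound `Φ τ ≤ a + b h(τ)` on `[t, s]`
  have hΦle : ∀ τ ∈ Icc t s,
      Φ τ ≤ a + b * (1 / (Real.sqrt (T - τ) * Real.sqrt (Real.sqrt (T - τ)))) := by
    intro τ hτ
    have hτS' : τ ∈ Icc 0 S := ⟨(ht0.trans_le hτ.1).le, (hτ.2.trans_lt hsS).le⟩
    have hτS : τ ∈ Ioo 0 S := ⟨ht0.trans_le hτ.1, hτ.2.trans_lt hsS⟩
    have hτ1 : τ ∈ Ioo T₁ T := ⟨ht.1.trans_le hτ.1, hτ.2.trans_lt hs.2⟩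
    have hτT : τ ∈ Ico 0 T := ⟨hτS.1.le, hτ1.2⟩
    have hTτ : 0 < T - τ := sub_pos.2 hτ1.2
    -- `r = (T - τ)^{1/4}`
    obtain ⟨r, hrdef⟩ : ∃ r : ℝ, r = Real.sqrt (Real.sqrt (T - τ)) := ⟨_, rfl⟩
    have hr2 : r ^ 2 = Real.sqrt (T - τ) := by rw [hrdef, Real.sq_sqrt (Real.sqrt_nonneg _)]
    have hrpos : 0 < r := by rw [hrdef]; exact Real.sqrt_pos.2 (Real.sqrt_pos.2 hTτ)
    -- the weight `λ(τ) = 1 / (8 q (T-τ)^{3/4})`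
    obtain ⟨lam, hlamdef⟩ : ∃ lam : ℝ, lam = 1 / (8 * q * (r ^ 2 * r)) := ⟨_, rfl⟩
    have hlampos : 0 < lam := by rw [hlamdef]; positivity
    -- the slice inequality in the class, and the enstrophy of `u τ`
    have hsl := slice_le_of_classical hν hS hsolS hB hτS hUt (hsol.divFree t htT) (l2sl t htS)
      (l2Dsl t htS) (hI τ hτ1) hlampos
    have hFτ := integral_frobeniusNormSq_le_of_curl ((hu τ hτS').of_le (by norm_cast))
      (hsol.divFree τ hτT) (l2sl τ hτS') (l2Dsl τ hτS')
      (by positivity : 0 ≤ K / Real.sqrt (T - τ)) (hslice τ hτT)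
    rw [← hr2, ← hGdef] at hsl
    rw [← hr2] at hFτ
    -- identify `Φ τ` and `E τ`
    have hΦeq : Φ τ = 2 * ∫ x, ⟪u τ x - u t x, timeDerivWithin (Icc 0 S) u τ x⟫ := by
      rw [hΦτ, ← integral_const_mul]
      refine integral_congr_ae (Eventually.of_forall fun x => ?_)
      simp only [hwtx, hWt τ hτS']
    have hEeq : ∫ x, ‖u τ x - u t x‖ ^ 2 = E τ := by
      rw [hEτ]; exact integral_congr_ae (Eventually.of_forall fun x => by simp only [hwtx])
    have hEY : E τ ≤ Y := by rw [hYdef]; exact hYge τ hτ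
    -- the three terms
    have h1 : ν / 2 * G ≤ a := by
      rw [hadef]; exact mul_le_mul_of_nonneg_left hGle (by positivity)
    have h2 : lam * (∫ x, ‖u τ x - u t x‖ ^ 2) ≤ Y / (8 * q) * (1 / (r ^ 2 * r)) := by
      rw [hEeq]
      calc lam * E τ ≤ lam * Y := mul_le_mul_of_nonneg_left hEY hlampos.le
        _ = Y / (8 * q) * (1 / (r ^ 2 * r)) := by rw [hlamdef]; field_simp
    have h3 : (C / r ^ 2) ^ 2 / lam * (∫ x, frobeniusNormSq (fderiv ℝ (u τ) x)) ≤
        8 * q * C ^ 2 * K * (1 / (r ^ 2 * r)) := by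
      calc (C / r ^ 2) ^ 2 / lam * (∫ x, frobeniusNormSq (fderiv ℝ (u τ) x))
          ≤ (C / r ^ 2) ^ 2 / lam * (K / r ^ 2) := mul_le_mul_of_nonneg_left hFτ.2 (by positivity)
        _ = 8 * q * C ^ 2 * K * (1 / (r ^ 2 * r)) := by
            rw [hlamdef]
            field_simp
    have hrw : Real.sqrt (T - τ) * Real.sqrt (Real.sqrt (T - τ)) = r ^ 2 * r := by
      rw [hr2, hrdef]
    rw [hrw, hΦeq]
    calc 2 * ∫ x, ⟪u τ x - u t x, timeDerivWithin (Icc 0 S) u τ x⟫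
        ≤ ν / 2 * G + lam * (∫ x, ‖u τ x - u t x‖ ^ 2) +
            (C / r ^ 2) ^ 2 / lam * ∫ x, frobeniusNormSq (fderiv ℝ (u τ) x) := hsl
      _ ≤ a + (Y / (8 * q) * (1 / (r ^ 2 * r)) + 8 * q * C ^ 2 * K * (1 / (r ^ 2 * r))) := by
          linarith [h1, h2, h3]
      _ = a + b * (1 / (r ^ 2 * r)) := by rw [hbdef]; ring
  -- integrate over `[t, σm]`
  have hσmT : σm < T := hσm.2.trans_lt hs.2
  have hσmS : σm ≤ S := (hσm.2.trans_lt hsS).le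
  have hconth : ContinuousOn (fun τ => 1 / (Real.sqrt (T - τ) * Real.sqrt (Real.sqrt (T - τ))))
      (Icc t σm) := by
    refine continuousOn_const.div
      (((continuous_const.sub continuous_id).sqrt.mul
        (continuous_const.sub continuous_id).sqrt.sqrt).continuousOn) fun τ hτ => ?_
    have hTτ : 0 < T - τ := by linarith [hτ.2]
    exact (mul_pos (Real.sqrt_pos.2 hTτ) (Real.sqrt_pos.2 (Real.sqrt_pos.2 hTτ))).ne'
  have hint_h := hconth.intervalIntegrable_of_Icc (μ := volume) hσm.1
  have hint_g : IntervalIntegrable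
      (fun τ => a + b * (1 / (Real.sqrt (T - τ) * Real.sqrt (Real.sqrt (T - τ))))) volume t σm :=
    intervalIntegrable_const.add (hint_h.const_mul b)
  have hmono : ∫ τ in t..σm, Φ τ ≤
      ∫ τ in t..σm, (a + b * (1 / (Real.sqrt (T - τ) * Real.sqrt (Real.sqrt (T - τ))))) :=
    intervalIntegral.integral_mono_on hσm.1 (hΦii t σm ht0.le hσmS hσm.1) hint_g
      fun τ hτ => hΦle τ ⟨hτ.1, hτ.2.trans hσm.2⟩
  have hcalc : ∫ τ in t..σm, (a + b * (1 / (Real.sqrt (T - τ) * Real.sqrt (Real.sqrt (T - τ))))) =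
      (σm - t) * a + b * (4 * q - 4 * Real.sqrt (Real.sqrt (T - σm))) := by
    rw [intervalIntegral.integral_add intervalIntegrable_const (hint_h.const_mul b),
      intervalIntegral.integral_const, intervalIntegral.integral_const_mul,
      integral_weight_eq hσm.1 hσmT, smul_eq_mul, hqdef]
  have hYle : Y ≤ (T - t) * a + 4 * b * q := by
    have e1 : Y = ∫ τ in t..σm, Φ τ := by rw [hYdef]; exact hEσ σm hσm
    have e2 : (σm - t) * a ≤ (T - t) * a :=
      mul_le_mul_of_nonneg_right (by linarith [hσmT]) ha0
    have e3 : b * (4 * q - 4 * Real.sqrt (Real.sqrt (T - σm))) ≤ 4 * b * q := by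
      have := Real.sqrt_nonneg (Real.sqrt (T - σm))
      nlinarith [hb0]
    linarith [hmono, hcalc]
  -- the bootstrap: `Y ≤ (ν/2)K√(T-t) + Y/2 + 32 C²K√(T-t)`
  have hY : Y ≤ (64 * C ^ 2 + ν) * K * q ^ 2 := by
    have e1 : (T - t) * a = ν / 2 * K * q ^ 2 := by
      rw [hadef, ← hq4]; field_simp
    have e2 : 4 * b * q = Y / 2 + 32 * C ^ 2 * K * q ^ 2 := by
      rw [hbdef]; field_simp; ring
    rw [e1, e2] at hYle
    linarith
  -- conclusion at `s`
  have hEs : ∫ x, ‖u s x - u t x‖ ^ 2 = E s := by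
    rw [hEτ]; exact integral_congr_ae (Eventually.of_forall fun x => by simp only [hwtx])
  rw [hEs, ← hq2]
  calc E s ≤ Y := by rw [hYdef]; exact hYge s ⟨hs.1.le, le_rfl⟩
    _ ≤ (64 * C ^ 2 + ν) * K * q ^ 2 := hY

/-! ### The edge law -/

/-- **THE EDGE LAW, explicit form** (Type-I rate + slice law ⇒ `‖u(t) − u(T)‖₂² ≤ (64C²+ν)K√(T−t)`).
Frame of the crux `NoTerminalJolt`: `ν > 0`, `T > 0`, `(u, p)` classical on `[0, T) × ℝ³`, Leray–Hopf
on `[0, T]` from the rapidly decaying datum `u 0`. If `∫|curl u(τ)|² ≤ K/√(T−τ)` on `[0, T)`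
(`K ≥ 0`) and `‖u(τ, x)‖ ≤ C/√(T−τ)` on `(T₁, T)` (`T₁ ≥ 0`), then for every `t ∈ (T₁, T)`:
`∫‖u(t) − u(T)‖² ≤ (64 C² + ν) K √(T−t)` — the member `α = 1/4` of the family
`‖u(t) − u(T)‖₂ = O((T−t)^α)`; the crux asks for `o((T−t)^{1/4})`. [folklore] -/
theorem integral_norm_sub_sq_le {ν T K C T₁ : ℝ} (hν : 0 < ν) (hT : 0 < T) (hK : 0 ≤ K)
    (hT₁ : 0 ≤ T₁) {u : ℝ → EuclideanSpace ℝ (Fin 3) → EuclideanSpace ℝ (Fin 3)}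
    {p : ℝ → EuclideanSpace ℝ (Fin 3) → ℝ}
    (hsol : IsClassicalNSSolutionOn (Ico 0 T) ν 0 u p) (hLH : IsLerayHopfOn T ν 0 (u 0) u)
    (hdec : HasRapidSpatialDecay (u 0))
    (hslice : ∀ τ ∈ Ico 0 T, ∫⁻ x, ‖curl (u τ) x‖ₑ ^ 2 ≤ ENNReal.ofReal (K / Real.sqrt (T - τ)))
    (hI : ∀ τ ∈ Ioo T₁ T, ∀ x, ‖u τ x‖ ≤ C / Real.sqrt (T - τ))
    {t : ℝ} (ht : t ∈ Ioo T₁ T) :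
    ∫ x, ‖u t x - u T x‖ ^ 2 ≤ (64 * C ^ 2 + ν) * K * Real.sqrt (T - t) :=
  integral_norm_sub_sq_terminal_le hT hLH ⟨hT₁.trans ht.1.le, ht.2⟩ fun _s hs =>
    integral_norm_sub_sq_le_of_lt hν hK hT₁ hsol hLH hdec hslice hI ht hs

/-- **THE EDGE LAW for the jolt functional**: under the hypotheses of `integral_norm_sub_sq_le`,
`D(t) = (√(T−t))⁻¹ ∫‖u(t) − u(T)‖² ≤ (64 C² + ν) K` on `(T₁, T)`. [folklore] -/
theorem joltFunctional_le {ν T K C T₁ : ℝ} (hν : 0 < ν) (hT : 0 < T) (hK : 0 ≤ K)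
    (hT₁ : 0 ≤ T₁) {u : ℝ → EuclideanSpace ℝ (Fin 3) → EuclideanSpace ℝ (Fin 3)}
    {p : ℝ → EuclideanSpace ℝ (Fin 3) → ℝ}
    (hsol : IsClassicalNSSolutionOn (Ico 0 T) ν 0 u p) (hLH : IsLerayHopfOn T ν 0 (u 0) u)
    (hdec : HasRapidSpatialDecay (u 0))
    (hslice : ∀ τ ∈ Ico 0 T, ∫⁻ x, ‖curl (u τ) x‖ₑ ^ 2 ≤ ENNReal.ofReal (K / Real.sqrt (T - τ)))
    (hI : ∀ τ ∈ Ioo T₁ T, ∀ x, ‖u τ x‖ ≤ C / Real.sqrt (T - τ))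
    {t : ℝ} (ht : t ∈ Ioo T₁ T) :
    (Real.sqrt (T - t))⁻¹ * ∫ x, ‖u t x - u T x‖ ^ 2 ≤ (64 * C ^ 2 + ν) * K := by
  have hsq : 0 < Real.sqrt (T - t) := Real.sqrt_pos.2 (sub_pos.2 ht.2)
  rw [inv_mul_le_iff₀ hsq]
  have h := integral_norm_sub_sq_le hν hT hK hT₁ hsol hLH hdec hslice hI ht
  linarith

/-- The slice law with constant `K` implies the slice law with the nonnegative constant `max K 0`. -/
theorem sliceLaw_max {T K : ℝ} {u : ℝ → EuclideanSpace ℝ (Fin 3) → EuclideanSpace ℝ (Fin 3)}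
    (hslice : ∀ τ ∈ Ico 0 T, ∫⁻ x, ‖curl (u τ) x‖ₑ ^ 2 ≤ ENNReal.ofReal (K / Real.sqrt (T - τ))) :
    ∀ τ ∈ Ico 0 T, ∫⁻ x, ‖curl (u τ) x‖ₑ ^ 2 ≤ ENNReal.ofReal (max K 0 / Real.sqrt (T - τ)) :=
  fun τ hτ => (hslice τ hτ).trans (ENNReal.ofReal_le_ofReal
    (div_le_div_of_nonneg_right (le_max_left K 0) (Real.sqrt_nonneg _)))

/-- **THE EDGE LAW under a Type-I rate** (`IsTypeIBlowup u T`, the tree's predicate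
`∃ C, ∀ᶠ t ↑ T, ∀ x, ‖u t x‖ ≤ C/√(T−t)`) and the slice law (any `K`): there are `D ≥ 0` and
`T₁ ∈ [0, T)` with `∫‖u(t) − u(T)‖² ≤ D √(T−t)` for all `t ∈ (T₁, T)`. [folklore] -/
theorem exists_integral_norm_sub_sq_le_of_isTypeIBlowup {ν T K : ℝ} (hν : 0 < ν) (hT : 0 < T)
    {u : ℝ → EuclideanSpace ℝ (Fin 3) → EuclideanSpace ℝ (Fin 3)} {p : ℝ → EuclideanSpace ℝ (Fin 3) → ℝ}
    (hsol : IsClassicalNSSolutionOn (Ico 0 T) ν 0 u p) (hLH : IsLerayHopfOn T ν 0 (u 0) u)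
    (hdec : HasRapidSpatialDecay (u 0))
    (hslice : ∀ τ ∈ Ico 0 T, ∫⁻ x, ‖curl (u τ) x‖ₑ ^ 2 ≤ ENNReal.ofReal (K / Real.sqrt (T - τ)))
    (hI : IsTypeIBlowup u T) :
    ∃ D T₁ : ℝ, 0 ≤ D ∧ 0 ≤ T₁ ∧ T₁ < T ∧
      ∀ t ∈ Ioo T₁ T, ∫ x, ‖u t x - u T x‖ ^ 2 ≤ D * Real.sqrt (T - t) := by
  obtain ⟨C, hC⟩ := hI
  obtain ⟨T₀, hT₀T, hT₀⟩ := mem_nhdsLT_iff_exists_Ioo_subset.1 hC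
  refine ⟨(64 * C ^ 2 + ν) * max K 0, max T₀ 0, by positivity, le_max_right _ _,
    max_lt hT₀T hT, fun t ht => ?_⟩
  have hI' : ∀ τ ∈ Ioo (max T₀ 0) T, ∀ x, ‖u τ x‖ ≤ C / Real.sqrt (T - τ) := fun τ hτ =>
    hT₀ ⟨(le_max_left _ _).trans_lt hτ.1, hτ.2⟩
  exact integral_norm_sub_sq_le hν hT (le_max_right K 0) (le_max_right T₀ 0) hsol hLH hdec
    (sliceLaw_max hslice) hI' ht

end EdgeLaw

end Summit.NavierStokesRegularity.NavierStokesRegularity.Theorems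

end
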